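import Literature.MathematicalPhysics.QuantumFieldTheory.Balaban1983to89.B9Eq319QQStarDiagonalZd
import Literature.MathematicalPhysics.QuantumFieldTheory.Balaban1983to89.B8Eq191FlatDirichletCoercive

/-!
# `Balaban1983to89.B9Thm31FlatPoincareCoerciveZd` — [Balaban1985BackgroundPropagators] Thm 3.1 p. 397 ∕ Thm 3.11 p. 416 with [Balaban1984PropagatorsII] (2.22) p. 226, (2.26)–(2.27)
# p. 235 and [Balaban1983RegularityDecay] (2.27) p. 580, AT THE FLAT BACKGROUND ON THE `ℤᵈ × 𝔸` CARRIER: THE MEMBER-UNIFORM COERCIVITY OF `Ω₀Δ′_a(1)Ω₀` BY THE BLOCK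
# POINCARÉ INEQUALITY — `a₀·⟨f, f⟩_τ ≤ ⟨f, Ω₀Δ′_a(1)Ω₀ f⟩_τ` on `L²(Ω₀, ·)` with `a₀ = min{8, a}` depending on NOTHING but the penalty weight (not on `η`, `m`, `M`, the
# member), whenever the level blocks of the constraint points partition `Ω₀` («Ω_j ∖ Ω_{j+1} = Bʲ(Λ_j)», «Ω₀ = ⋃_j Bʲ(Λ_j)») — proved with NO geometric hypothesis left at every cube
# member of [Balaban1985RegularSpaces] (1.131); this replaces the box-size dependent Friedrichs constant `((Mc+4ρ)²)⁻¹` of this seat's g4 `B9Thm31FriedrichsCoerciveZd` by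
# print's scale-free one at `U₀ = 1`

statement-level skeleton of published theorems with citation tags; proofs where landed; nothing here is a claim about the
Yang–Mills mass gap

`[Balaban1984PropagatorsII]` ("[4]" of [Balaban1985BackgroundPropagators], CMP **96** (1984) 223–250) (2.22) p. 226 (the lower bound of the multi-level form), (2.26)–(2.27)
p. 235 (block by block: Poincaré + block mean); `[Balaban1983RegularityDecay]` (CMP **89** (1983) 571–597) (2.27) p. 580 (the block inequality, repaired constant `min{8, a}`
— the tree's kernel theorem `B4Block227.block227_real`, transported to `ℤᵈ` blocks by dag-n05-c as `B8Eq191FlatDirichletCoercive.block227_zd`);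
`[Balaban1985BackgroundPropagators]` ("B9", CMP **99** (1985) 389–434) (3.23)–(3.24) p. 394 (`Δ′_a = D*D + Σ_j a_j Q′_j*Q′_j` at the background, `Ω₀Δ′_aΩ₀`), p. 393
«Λ_j = Ω_j^{(j)} ∖ Ω_{j+1}^{(j)}, … Ω_j ∖ Ω_{j+1} = Bʲ(Λ_j)», Thm 3.1 p. 397 ∕ Thm 3.11 p. 416 («Δ′_a, G′ … positive definite»); `[Balaban1985RegularSpaces]` (1.131) p. 99,
p. 98 («□_j is a sum of the big blocks»).  PDF held: `paper:balaban1985-cmp99-background-propagators` pp. 393–394, 416 (re-read 2026-08-28); [4]'s displays via dag-n05-c's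
`B8Eq191FlatDirichletCoercive` header (verbatim quotes there).

CITATION HEADER (lean-in-tree rule).  Cell `pub-ymgap` (YM Track A, D-0062 ∕ D-0149), node N06 = [B9], width seat `pub-ymgap-dag-n06-w4` (g5), CLAIM-5 ∕ INTENT-5.  WHY: dag-n06-b g20's
census names «member-UNIFORM constants» as the node's debt; for the `Δ′_a ∕ G′` letters this seat's g4 gave a member-uniform but BOX-SIZE dependent Friedrichs constant; print's
constant is scale-free because the averaging penalty supplies the mass block by block — [4] (2.22).  dag-n05-c g8 PROVED that flat multi-level bound for REAL scalar fields on the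
explicit real kernel of `B8Eq191FlatDirichletForm` (`weighted_coercive_flatDirichlet`, `block227_zd`); THIS FILE carries it to the N06 OBJECTS — the `𝔸`-valued `L²(Ω₀, ·)` of
`B9Eq321LandauProjectionZd` with the `τ`-pairing and g2's operator `B9Eq324DeltaPrimeAZd.deltaPrimeADom` — by decomposing `|·|²_τ` into squares of real functionals, and adds
the COVER of `□₀` by the truncated constraint blocks (so the bound is on ALL of `⟨f, f⟩_τ`).  Inputs BY NAME: `B8Eq191FlatDirichletCoercive.block227_zd` (dag-n05-c),
`B8Eq191FlatLettersCubeMember` (`under_iff_blockMap_eq`, `cubeFam_subset_zero`, `towers_disjoint_cube`; dag-n05-e), `B8Eq131Cubes.mem_cube_iff`, `B8Eq131CubesAdmissible.smul_mem_cube_succ_iff`,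
`B8CubeMemberZd` (`cubeLamS_of_lt ∕ _self`, `inBox_sq_of_mem_cubeLamS`, `under_smul_iff`), g2 `B9Eq324DeltaPrimeAZd` (`formE_deltaPrimeADom`, `eq_sum_single`, `QprimeLin`),
`B9Eq325QprimeSingleSiteZd` (`trIter`, `QprimeIter_single`, `blockMapIter_eq_blockMap_pow`), dag-n06-w2's `B9Eq342CombesThomasFormZd` (`fnorm`, `fnorm_sq_eq_fibreForm`, `formE_self_eq_sum_sq`),
Mathlib `LinearMap.BilinForm.exists_orthogonal_basis`.

WHAT IS PROVED (kernel, 0 sorry; theorems only — no `def`, `instance`, `notation`; faithful Hermitian tracial `τ` a PARAMETER; `η > 0`).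
* §1 `fibreForm_isSymm`, ★ `exists_fnorm_sq_eq_sum_sq` (`|a|²_τ = Σ_i β_i ℓ_i(a)²`, `β_i ≥ 0`, `ℓ_i` real linear — an orthogonal basis of `Re τ(a* b)`).
* §2 ★★ `block227_zd_fnorm` ([B4] (2.27) on a `ℤᵈ` block for `𝔸`-valued fields: `min{8,a′}·Σ_B |F|²_τ ≤ (n+1)²Σ_μΣ_{x,x+e_μ∈B}|F x − F(x+e_μ)|²_τ + a′(n+1)^{−d}|Σ_B F|²_τ`).
* §3 (flat letters; `conjR_unitOne`, `covDerivFwd_flat_apply` are dag-n05's `B8Eq191FlatStencils`) `trIter_one`, ★ `QprimeIter_one_eq_blockSum`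
  (`(Q′_j(1)f)(y) = (Lᵈ)^{−j}·Σ_{Bʲ(y)} f`; cf. `B8Eq191FlatStencils.QprimeIter_flat_eq_sum_of_supp`), `fnorm_covDerivFwd_one_sq`.
* §4 ★★ `block_coercive_one` (one block, weighted: `a₀·Σ_{Bʲ(y)}|f|²_τ ≤ η⁻²Σ_{internal bonds}|δf|²_τ + a_j|(Q′_j(1)f)(y)|²_τ` for `η·Lʲ ≤ 1`, `a₀ ≤ 8`, `a₀(Lʲ)^d ≤ a_jη²(Lʲ)²`).
* §5 ★★★ `formE_deltaPrimeADom_one_coercive_uniform` (`B9Eq319QQStarDiagonalZd.FullBlockGeometry` + COVER of the blocks ⟹ `a₀·⟨f, f⟩_τ ≤ ⟨f, Ω₀Δ′_a(1)Ω₀ f⟩_τ`).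
* §6 `under_succ_of_under_one_under`, `mem_cube_succ_of_inBox_in`, `inBox_sq_blockMap_of_mem_cube`, ★★ `cover_cubeLamS` (every site of `□₀` lies under a constraint point of the
  truncated cube family, `m` arbitrary), ★★★ `formE_deltaPrimeADom_one_coercive_cubeMember` (the bound at every cube member, no geometric hypothesis).

HONEST SCOPE.  (i) The FLAT background only (`U₀ = 1`); the curved statement of Thm 3.1 ∕ 3.11 (class (3.35)) needs the small-field perturbation of the letters and is
NOT here.  (ii) The constant is `a₀ = min{8, min_j a_jη²L^{(2−d)j}}` — uniform exactly when the weights carry print's scaling `a_j = a·η⁻²L^{(d−2)j}` (the tree's `a : ℕ → ℝ` is a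
free parameter; the hypothesis displays the relation).  (iii) `L²_τ` currency, no decay.  Count-neutral helper (`--supports` the K1 item of record); N05 ∕ N06 NOT discharged;
K1 NOT closed; one finite `𝕋⁴` programme at fixed `ε`, Bałaban as printed; R4 closes only the conditional finite-`𝕋⁴` rung `BalabanLadder.UV` — nothing continuum ∕ ℝ⁴ ∕ OS ∕
mass gap ∕ Clay.  Unit `pub-ymgap-dag-n06-w4` (g5), 2026-08-28.
-/

noncomputable section

namespace Literature.MathematicalPhysics.QuantumFieldTheory.Balaban1983to89.B9Thm31FlatPoincareCoerciveZd

open B7Prop1Explicit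
open Literature.MathematicalPhysics.QuantumLattice (blockMap blockSites mem_blockSites_iff card_blockSites blockBase)
open B9Eq324DeltaPrimeAZd (fibreForm fibreForm_apply fibreForm_comm)
open B9Eq342CombesThomasFormZd (fnorm fnorm_nonneg fnorm_sq fnorm_sq_eq_fibreForm fnorm_smul fnorm_zero formE_self_eq_sum_sq)
open B8Eq191FlatDirichletCoercive (block227_zd)
open B8Eq191FlatStencils (conjR_unitOne covDerivFwd_flat_apply)
open B7Prop1Local (InBox)
open B8Ineq132 (Under)
open B8Eq131Cubes (cube sqLo sqHi inLo inHi mem_cube_iff)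
open B8Eq131CubesAdmissible (cubeFam cubeFam_false_of_le smul_mem_cube_succ_iff)
open B8CubeMemberZd (cubeLamS cubeLamS_of_lt cubeLamS_self inBox_sq_of_mem_cubeLamS under_smul_iff)
open B8LeafModelZd (ZdIdx)
open B8Eq191FlatLettersCubeMember (under_iff_blockMap_eq cubeFam_subset_zero towers_disjoint_cube cubeLamS_finite)
open B9Thm311PosDefOpenZd (cubeMember_Ω0_finite)
open B9Eq319QQStarDiagonalZd (mem_blockSites_pow_iff FullBlockGeometry fullBlockGeometry_cubeMember)
open B7Eq78Linearization (conjR conjR_apply QprimeIter zdBlocking)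
open B7Prop2Explicit (unitaryUnits)
open B8Ineq132 (covDerivFwd)
open B8Eq119TwistedAxial (bgT bgT_one)
open B9Eq321LandauProjectionZd (suppSub formE formE_apply)
open B9Eq324DeltaPrimeAZd (single eq_sum_single QprimeLin QprimeLin_apply deltaPrimeADom formE_deltaPrimeADom)
open B9Eq325QprimeSingleSiteZd (blockMapIter blockMapIter_eq_blockMap_pow trIter trIter_zero trIter_succ QprimeIter_single)
open B9Thm31GpDecayOfCoerciveZd (fnorm_neg')

-- `Site` alone could resolve to the torus sites of `Setup.lean`; re-export the `ℤ^d` sites of `B7Prop1Explicit`.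
export B7Prop1Explicit (Site)

variable {d : ℕ} {𝔸 : Type*} [CStarAlgebra 𝔸]
variable (τ : 𝔸 →ₗ[ℂ] ℂ) (hτp : ∀ a : 𝔸, a ≠ 0 → 0 < (τ (star a * a)).re)
  (hτt : ∀ a b : 𝔸, τ (a * b) = τ (b * a)) (hτs : ∀ a : 𝔸, τ (star a) = starRingEnd ℂ (τ a))

/-! ## §1  The fibre size squared is a non-negative combination of squares of real functionals -/

section Fibre

variable [FiniteDimensional ℝ 𝔸]

omit [FiniteDimensional ℝ 𝔸] in
include hτs in
/-- the fibre pairing `Re τ(a* b)` is a symmetric real bilinear form (Hermitian `τ`). [cite: Balaban1985BackgroundPropagators, p.391 («natural L² scalar products»)] -/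
theorem fibreForm_isSymm : LinearMap.IsSymm (fibreForm (𝔸 := 𝔸) τ) :=
  LinearMap.BilinForm.isSymm_iff.1 ⟨fun a b => fibreForm_comm τ hτs a b⟩

include hτp hτs in
/-- ★ **`|a|²_τ = Σ_i β_i·ℓ_i(a)²`** for finitely many REAL LINEAR functionals `ℓ_i` and weights `β_i ≥ 0` (an orthogonal basis of the symmetric form `Re τ(a* b)`
on the finite-dimensional real space `𝔸`): the device that transfers real-valued lattice inequalities to `𝔸`-valued fields sitewise.
[cite: Balaban1985BackgroundPropagators, p.390 («|X|² = tr X*X»), p.391] -/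
theorem exists_fnorm_sq_eq_sum_sq :
    ∃ (N : ℕ) (ℓ : Fin N → (𝔸 →ₗ[ℝ] ℝ)) (β : Fin N → ℝ), (∀ i, 0 ≤ β i) ∧ ∀ a : 𝔸, fnorm τ a ^ 2 = ∑ i, β i * (ℓ i a) ^ 2 := by
  classical
  obtain ⟨v, hv⟩ := LinearMap.BilinForm.exists_orthogonal_basis (fibreForm_isSymm τ hτs)
  refine ⟨Module.finrank ℝ 𝔸, fun i => v.coord i, fun i => fibreForm τ (v i) (v i), fun i => ?_, fun a => ?_⟩
  · show 0 ≤ fibreForm τ (v i) (v i)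
    rw [← fnorm_sq_eq_fibreForm hτp]
    exact sq_nonneg _
  · -- expand `a = Σ_i c_i v_i` in the second slot, then in the first, and use orthogonality
    have hrepr : ∑ i, v.repr a i • v i = a := v.sum_repr a
    have h1 : fibreForm τ a a = ∑ j, v.repr a j * fibreForm τ a (v j) := by
      calc fibreForm τ a a = fibreForm τ a (∑ i, v.repr a i • v i) := by rw [hrepr]
        _ = ∑ j, v.repr a j * fibreForm τ a (v j) := by
          rw [map_sum]
          exact Finset.sum_congr rfl fun j _ => by rw [map_smul, smul_eq_mul]
    have h2 : ∀ j, fibreForm τ a (v j) = ∑ i, v.repr a i * fibreForm τ (v i) (v j) := by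
      intro j
      conv_lhs => rw [← hrepr]
      rw [map_sum, LinearMap.sum_apply]
      exact Finset.sum_congr rfl fun i _ => by rw [map_smul, LinearMap.smul_apply, smul_eq_mul]
    have h3 : ∀ j, fibreForm τ a (v j) = v.repr a j * fibreForm τ (v j) (v j) := by
      intro j
      rw [h2 j, Finset.sum_eq_single j (fun i _ hij => ?_) (fun h => absurd (Finset.mem_univ j) h)]
      rw [LinearMap.isOrthoᵢ_def.1 hv i j hij, mul_zero]
    rw [fnorm_sq_eq_fibreForm hτp, h1]
    refine Finset.sum_congr rfl fun j _ => ?_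
    rw [h3 j, Module.Basis.coord_apply]
    ring

end Fibre

/-! ## §2  [Balaban1983RegularityDecay] (2.27) on a block of `ℤᵈ` for `𝔸`-valued fields -/

section Block

variable [FiniteDimensional ℝ 𝔸]

include hτp hτs in
/-- ★★ **THE BLOCK INEQUALITY (2.27) FOR `𝔸`-VALUED FIELDS**: on a block `B = {x : blockMap (n+1) x = y}` of side `n + 1` in `ℤᵈ`, for every `F : ℤᵈ → 𝔸` and
every `a′`, `min{8, a′}·Σ_{x∈B} |F x|²_τ ≤ (n+1)²·Σ_μ Σ_{x, x+e_μ ∈ B} |F x − F(x+e_μ)|²_τ + a′(n+1)^{−d}·|Σ_{x∈B} F x|²_τ` — dag-n05-c's real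
`B8Eq191FlatDirichletCoercive.block227_zd` applied to each functional of §1 and re-summed with the weights `β_i ≥ 0`.
[cite: Balaban1983RegularityDecay, (2.27) p.580; Balaban1984PropagatorsII, (2.26)–(2.27) p.235; Balaban1985BackgroundPropagators, (3.23) p.394] -/
theorem block227_zd_fnorm (n : ℕ) (y : Site d) (B : Finset (Site d)) (hB : ∀ x, x ∈ B ↔ blockMap (n + 1) x = y) (a' : ℝ) (F : Site d → 𝔸) :
    min 8 a' * ∑ x ∈ B, fnorm τ (F x) ^ 2
      ≤ ((n : ℝ) + 1) ^ 2 * ∑ μ : Fin d, ∑ x ∈ B.filter (fun x => x + e μ ∈ B), fnorm τ (F x - F (x + e μ)) ^ 2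
        + a' * (((n : ℝ) + 1) ^ d)⁻¹ * fnorm τ (∑ x ∈ B, F x) ^ 2 := by
  classical
  obtain ⟨N, ℓ, β, hβ, hsq⟩ := exists_fnorm_sq_eq_sum_sq τ hτp hτs
  -- the scalar inequalities, weighted
  have h := fun i : Fin N => mul_le_mul_of_nonneg_left (block227_zd n y B hB a' (fun x => ℓ i (F x))) (hβ i)
  have hsum := Finset.sum_le_sum fun i (_ : i ∈ Finset.univ) => h i
  -- two interchange identities
  have swap1 : ∀ (S : Finset (Site d)) (u : Fin N → Site d → ℝ), ∑ x ∈ S, ∑ i, β i * u i x = ∑ i, β i * ∑ x ∈ S, u i x := by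
    intro S u
    rw [Finset.sum_comm]
    simp only [Finset.mul_sum]
  have swap2 : ∀ (w : Fin N → Fin d → Site d → ℝ),
      ∑ μ : Fin d, ∑ x ∈ B.filter (fun x => x + e μ ∈ B), ∑ i, β i * w i μ x =
        ∑ i, β i * ∑ μ : Fin d, ∑ x ∈ B.filter (fun x => x + e μ ∈ B), w i μ x := by
    intro w
    rw [Finset.sum_congr rfl fun μ _ => swap1 _ (fun i x => w i μ x), Finset.sum_comm]
    simp only [Finset.mul_sum]
  -- the three terms through the decomposition
  have e1 : ∑ x ∈ B, fnorm τ (F x) ^ 2 = ∑ i, β i * ∑ x ∈ B, (ℓ i (F x)) ^ 2 := by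
    rw [Finset.sum_congr rfl fun x _ => hsq (F x), swap1]
  have e2 : ∑ μ : Fin d, ∑ x ∈ B.filter (fun x => x + e μ ∈ B), fnorm τ (F x - F (x + e μ)) ^ 2 =
      ∑ i, β i * ∑ μ : Fin d, ∑ x ∈ B.filter (fun x => x + e μ ∈ B), (ℓ i (F x) - ℓ i (F (x + e μ))) ^ 2 := by
    rw [Finset.sum_congr rfl fun μ _ => Finset.sum_congr rfl fun x _ => hsq (F x - F (x + e μ))]
    simp only [map_sub]
    exact swap2 (fun i μ x => (ℓ i (F x) - ℓ i (F (x + e μ))) ^ 2)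
  have e3 : fnorm τ (∑ x ∈ B, F x) ^ 2 = ∑ i, β i * (∑ x ∈ B, ℓ i (F x)) ^ 2 := by
    rw [hsq]
    exact Finset.sum_congr rfl fun i _ => by rw [map_sum]
  rw [e1, e2, e3, Finset.mul_sum, Finset.mul_sum, Finset.mul_sum, ← Finset.sum_add_distrib]
  calc ∑ i, min 8 a' * (β i * ∑ x ∈ B, (ℓ i (F x)) ^ 2)
      = ∑ i, β i * (min 8 a' * ∑ x ∈ B, (ℓ i (F x)) ^ 2) := Finset.sum_congr rfl fun i _ => by ring
    _ ≤ _ := hsum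
    _ = _ := Finset.sum_congr rfl fun i _ => by ring

end Block

/-! ## §3  The flat letters: `trIter_j(1) = (Lᵈ)^{−j}`, `Q′_j(1) f = (Lᵈ)^{−j}·(block sums)`, `D^η_1 = η⁻¹·(finite difference)` -/

section Flat

variable {L : ℕ} {s : Finset (Site d)}

/-- at the flat background the fibre transport is the scalar `(Lᵈ)^{−j}`: `trIter_j(1) x X = ((Lᵈ)⁻¹)ʲ • X`. [cite: Balaban1985BackgroundPropagators, (3.18)–(3.19) p.393] -/
theorem trIter_one (x : Site d) (X : 𝔸) : ∀ j : ℕ, trIter L (1 : Site d → Fin d → 𝔸ˣ) j x X = (((L : ℝ) ^ d)⁻¹) ^ j • X := by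
  intro j
  induction j with
  | zero => rw [trIter_zero, pow_zero, one_smul]
  | succ j ih =>
    rw [trIter_succ, ih, bgT_one, conjR_unitOne, smul_smul, pow_succ, mul_comm]

variable [NeZero L]

/-- ★ **`Q′_j(1)` IS THE SCALED BLOCK SUM**: for `f ∈ L²(Ω₀, ·)`, `(Q′_j(1) f)(y) = ((Lᵈ)⁻¹)ʲ • Σ_{x ∈ Bʲ(y)} f(x)` (the sites of the block off `Ω₀` carry `f = 0`).
[cite: Balaban1985BackgroundPropagators, (3.18)–(3.19) p.393; Balaban1984PropagatorsI, (1.18) p.20] -/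
theorem QprimeIter_one_eq_blockSum (f : suppSub (𝔸 := 𝔸) s) (j : ℕ) (y : Site d) :
    QprimeIter (zdBlocking d L) (bgT L (1 : Site d → Fin d → 𝔸ˣ)) j (f : Site d → 𝔸) y =
      (((L : ℝ) ^ d)⁻¹) ^ j • ∑ x ∈ blockSites (L ^ j) y, (f : Site d → 𝔸) x := by
  classical
  -- expand `f` over its support
  have hf : (f : Site d → 𝔸) = ∑ x ∈ s, single x ((f : Site d → 𝔸) x) :=
    eq_sum_single fun k hk => by by_contra hks; exact hk (f.2 k hks)
  have h1 : QprimeIter (zdBlocking d L) (bgT L (1 : Site d → Fin d → 𝔸ˣ)) j (f : Site d → 𝔸) y =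
      ∑ x ∈ s, QprimeIter (zdBlocking d L) (bgT L (1 : Site d → Fin d → 𝔸ˣ)) j (single x ((f : Site d → 𝔸) x)) y := by
    have h := congr_fun (map_sum (QprimeLin L (1 : Site d → Fin d → 𝔸ˣ) j) (fun x => single x ((f : Site d → 𝔸) x)) s) y
    simp only [QprimeLin_apply, Finset.sum_apply] at h
    rw [← hf] at h
    exact h
  rw [h1, Finset.sum_congr rfl fun x _ => QprimeIter_single L (1 : Site d → Fin d → 𝔸ˣ) x ((f : Site d → 𝔸) x) j y]
  simp_rw [trIter_one]
  rw [← Finset.sum_filter, ← Finset.smul_sum]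
  congr 1
  -- the filtered support IS the part of the block carrying `f`
  refine Finset.sum_subset (fun x hx => ?_) (fun x hxB hx => ?_)
  · rw [Finset.mem_filter] at hx
    exact (mem_blockSites_pow_iff j y x).2 hx.2
  · have hxs : x ∉ s := by
      intro h'
      exact hx (Finset.mem_filter.2 ⟨h', (mem_blockSites_pow_iff j y x).1 hxB⟩)
    exact f.2 x hxs

omit [NeZero L] in
/-- `|D^η_{1,μ}F(x)|²_τ = η⁻²·|F x − F(x+e_μ)|²_τ`. [cite: Balaban1985BackgroundPropagators, (3.23) p.394 (bookkeeping)] -/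
theorem fnorm_covDerivFwd_one_sq (η : ℝ) (μ : Fin d) (F : Site d → 𝔸) (x : Site d) :
    fnorm τ (covDerivFwd η (1 : Site d → Fin d → 𝔸ˣ) μ F x) ^ 2 = (η ^ 2)⁻¹ * fnorm τ (F x - F (x + e μ)) ^ 2 := by
  rw [covDerivFwd_flat_apply, fnorm_smul, mul_pow, sq_abs, inv_pow, ← neg_sub, fnorm_neg']

end Flat

/-! ## §4  One block: `a₀·Σ_{Bʲ(y)} |f|²_τ ≤ η⁻²·Σ_{internal bonds} |δf|²_τ + a_j·|(Q′_j(1)f)(y)|²_τ` -/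

section OneBlock

variable [FiniteDimensional ℝ 𝔸] {L : ℕ} [NeZero L] {η : ℝ} {s : Finset (Site d)}

include hτp hτs in
/-- ★★ **THE WEIGHTED BLOCK INEQUALITY AT THE FLAT BACKGROUND** ([Balaban1984PropagatorsII] (2.26)–(2.27) × `(Lʲη)⁻²`): for a level `j` with `η·Lʲ ≤ 1`, a weight
`a_j ≥ 0` and any `a₀ ≤ 8` with `a₀·(Lʲ)^d ≤ a_j·η²·(Lʲ)²` (print's `a_j = a·η⁻²L^{(d−2)j}` gives `a₀ = min{8, a}`), every `f ∈ L²(Ω₀, ·)` satisfies on the block `Bʲ(y)`: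
`a₀·Σ_{x∈Bʲ(y)} |f x|²_τ ≤ η⁻²·Σ_μ Σ_{x, x+e_μ ∈ Bʲ(y)} |f x − f(x+e_μ)|²_τ + a_j·|(Q′_j(1) f)(y)|²_τ`.
[cite: Balaban1984PropagatorsII, (2.26)–(2.27) p.235; Balaban1983RegularityDecay, (2.27) p.580; Balaban1985BackgroundPropagators, (3.23) p.394] -/
theorem block_coercive_one (hη : 0 < η) {j : ℕ} (hηL : η * (L : ℝ) ^ j ≤ 1) {aj a₀ : ℝ} (haj : 0 ≤ aj) (ha₀8 : a₀ ≤ 8)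
    (ha₀ : a₀ * ((L : ℝ) ^ j) ^ d ≤ aj * η ^ 2 * ((L : ℝ) ^ j) ^ 2) (y : Site d) (f : suppSub (𝔸 := 𝔸) s) :
    a₀ * ∑ x ∈ blockSites (L ^ j) y, fnorm τ ((f : Site d → 𝔸) x) ^ 2
      ≤ (η ^ 2)⁻¹ * ∑ μ : Fin d, ∑ x ∈ (blockSites (L ^ j) y).filter (fun x => x + e μ ∈ blockSites (L ^ j) y),
            fnorm τ ((f : Site d → 𝔸) x - (f : Site d → 𝔸) (x + e μ)) ^ 2
        + aj * fnorm τ (QprimeIter (zdBlocking d L) (bgT L (1 : Site d → Fin d → 𝔸ˣ)) j (f : Site d → 𝔸) y) ^ 2 := by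
  classical
  have hL0 : (0 : ℝ) < (L : ℝ) := by exact_mod_cast Nat.pos_of_ne_zero (NeZero.ne L)
  set N : ℝ := (L : ℝ) ^ j with hNdef
  have hN : 0 < N := by positivity
  set D : ℝ := N ^ d with hDdef
  have hD : 0 < D := by positivity
  have hη2 : 0 < η ^ 2 := by positivity
  have hηne : η ≠ 0 := hη.ne'
  -- the block as `{x : blockMap (n+1) x = y}` with `n + 1 = Lʲ`
  have hNsucc : L ^ j - 1 + 1 = L ^ j := Nat.sub_add_cancel (Nat.one_le_pow _ _ (Nat.pos_of_ne_zero (NeZero.ne L)))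
  haveI : NeZero (L ^ j) := ⟨pow_ne_zero j (NeZero.ne L)⟩
  have hB : ∀ x : Site d, x ∈ blockSites (L ^ j) y ↔ blockMap (L ^ j - 1 + 1) x = y := by
    intro x
    rw [hNsucc]
    exact mem_blockSites_iff (L ^ j) y x
  have hcast : ((L ^ j - 1 : ℕ) : ℝ) + 1 = N := by
    have h1 : ((L ^ j - 1 : ℕ) : ℝ) + 1 = ((L ^ j - 1 + 1 : ℕ) : ℝ) := by push_cast; ring
    rw [h1, hNsucc]
    push_cast
    rfl
  -- the scaled weight
  set a' : ℝ := aj * η ^ 2 * N ^ 2 * D⁻¹ with ha'def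
  have ha'0 : 0 ≤ a' := by positivity
  have h227 := block227_zd_fnorm τ hτp hτs (L ^ j - 1) y (blockSites (L ^ j) y) hB a' (f : Site d → 𝔸)
  rw [hcast] at h227
  -- abbreviations
  set S0 := ∑ x ∈ blockSites (L ^ j) y, fnorm τ ((f : Site d → 𝔸) x) ^ 2 with hS0
  set S1 := ∑ μ : Fin d, ∑ x ∈ (blockSites (L ^ j) y).filter (fun x => x + e μ ∈ blockSites (L ^ j) y),
    fnorm τ ((f : Site d → 𝔸) x - (f : Site d → 𝔸) (x + e μ)) ^ 2 with hS1
  set S2 := fnorm τ (∑ x ∈ blockSites (L ^ j) y, (f : Site d → 𝔸) x) ^ 2 with hS2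
  have hS0nn : 0 ≤ S0 := Finset.sum_nonneg fun _ _ => sq_nonneg _
  have hS1nn : 0 ≤ S1 := Finset.sum_nonneg fun _ _ => Finset.sum_nonneg fun _ _ => sq_nonneg _
  -- the averaging term: `|Q′_j(1) f (y)|² = D⁻² · S2`
  have hQ : fnorm τ (QprimeIter (zdBlocking d L) (bgT L (1 : Site d → Fin d → 𝔸ˣ)) j (f : Site d → 𝔸) y) ^ 2 = (D⁻¹) ^ 2 * S2 := by
    rw [QprimeIter_one_eq_blockSum, fnorm_smul, mul_pow, sq_abs, hS2, hDdef, hNdef]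
    congr 1
    rw [inv_pow, ← pow_mul, ← pow_mul, mul_comm]
  -- scale (2.27) by `c = (η²N²)⁻¹ ≥ 1`
  set c : ℝ := (η ^ 2)⁻¹ * (N ^ 2)⁻¹ with hcdef
  have hc0 : 0 < c := by positivity
  have hc1 : 1 ≤ c := by
    rw [hcdef, ← mul_inv, one_le_inv_iff₀]
    refine ⟨by positivity, ?_⟩
    calc η ^ 2 * N ^ 2 = (η * N) ^ 2 := by ring
      _ ≤ 1 := by
        have h0 : 0 ≤ η * N := by positivity
        nlinarith [h0, hηL]
  have hscaled : min 8 a' * c * S0 ≤ (η ^ 2)⁻¹ * S1 + aj * ((D⁻¹) ^ 2 * S2) := by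
    have h := mul_le_mul_of_nonneg_left h227 hc0.le
    have e1 : c * (min 8 a' * S0) = min 8 a' * c * S0 := by ring
    have e2 : c * (N ^ 2 * S1 + a' * D⁻¹ * S2) = (η ^ 2)⁻¹ * S1 + aj * ((D⁻¹) ^ 2 * S2) := by
      rw [hcdef, ha'def]
      field_simp
    rw [e1, e2] at h
    exact h
  -- `a₀ ≤ min 8 a' ≤ min 8 a' · c`
  have ha₀a' : a₀ ≤ a' := by
    rw [ha'def, hDdef, hNdef]
    rw [le_mul_inv_iff₀ hD]
    exact ha₀
  have hmin : a₀ ≤ min 8 a' * c := by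
    have h1 : a₀ ≤ min 8 a' := le_min ha₀8 ha₀a'
    have h2 : 0 ≤ min 8 a' := le_min (by norm_num) ha'0
    calc a₀ ≤ min 8 a' := h1
      _ = min 8 a' * 1 := (mul_one _).symm
      _ ≤ min 8 a' * c := mul_le_mul_of_nonneg_left hc1 h2
  calc a₀ * S0 ≤ min 8 a' * c * S0 := mul_le_mul_of_nonneg_right hmin hS0nn
    _ ≤ (η ^ 2)⁻¹ * S1 + aj * ((D⁻¹) ^ 2 * S2) := hscaled
    _ = (η ^ 2)⁻¹ * S1 + aj * fnorm τ (QprimeIter (zdBlocking d L) (bgT L (1 : Site d → Fin d → 𝔸ˣ)) j (f : Site d → 𝔸) y) ^ 2 := by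
        rw [hQ]

end OneBlock

/-! ## §5  Assembly over the block partition of `Ω₀`: the FLAT UNIFORM COERCIVITY of `Ω₀Δ′_a(1)Ω₀` -/

section Assembly

variable [FiniteDimensional ℝ 𝔸] {L : ℕ} [NeZero L] {η : ℝ}

include hτt hτs in
/-- ★★★ **THE FLAT UNIFORM COERCIVITY OF `Ω₀Δ′_a(1)Ω₀`** ([Balaban1984PropagatorsII] (2.22) ∕ [Balaban1985BackgroundPropagators] Thm 3.1's positivity at `U₀ = 1`, with a
MEMBER-UNIFORM constant): if the level blocks of the constraint points lie in `Ω₀` and are pairwise disjoint (print's «Ω_j ∖ Ω_{j+1} = Bʲ(Λ_j)»), COVER `Ω₀`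
(«Ω₀ = ⋃_j Bʲ(Λ_j)», `Ω_{k+1} = ∅`), `η·Lʲ ≤ 1` for `j ≤ m`, and the weights satisfy `a₀·(Lʲ)^d ≤ a_j·η²·(Lʲ)²` for some `a₀ ≤ 8` (print's `a_j = a·η⁻²L^{(d−2)j}`: `a₀ = min{8, a}`),
then for every `f ∈ L²(Ω₀, ·)`: `a₀·⟨f, f⟩_τ ≤ ⟨f, Ω₀Δ′_a(1)Ω₀ f⟩_τ` — a constant depending on `a₀` ONLY (not on `η`, `m`, `M`, the member).
[cite: Balaban1984PropagatorsII, (2.22) p.226, (2.26)–(2.27) p.235; Balaban1985BackgroundPropagators, Thm 3.1 p.397, (3.23)–(3.24) p.394, Thm 3.11 p.416; Balaban1983RegularityDecay, (2.27) p.580] -/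
theorem formE_deltaPrimeADom_one_coercive_uniform (hη : 0 < η) (m : ℕ) {a : ℕ → ℝ} (ha : ∀ j, 0 ≤ a j)
    (Λ : ℕ → Finset (Site d)) {s : Finset (Site d)}
    (hG : FullBlockGeometry L m Λ s) (hcov : ∀ x ∈ s, ∃ j ∈ Finset.range (m + 1), blockMapIter L j x ∈ Λ j)
    (hηL : ∀ j ∈ Finset.range (m + 1), η * (L : ℝ) ^ j ≤ 1)
    {a₀ : ℝ} (ha₀8 : a₀ ≤ 8) (ha₀ : ∀ j ∈ Finset.range (m + 1), a₀ * ((L : ℝ) ^ j) ^ d ≤ a j * η ^ 2 * ((L : ℝ) ^ j) ^ 2)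
    (f : suppSub (𝔸 := 𝔸) s) :
    a₀ * formE τ s f f ≤ formE τ s f (deltaPrimeADom L (1 : Site d → Fin d → 𝔸ˣ) η τ hτp m a Λ s f) := by
  classical
  set F : Site d → 𝔸 := (f : Site d → 𝔸) with hF
  -- the constraint set `𝔅` and the blocks
  set B : Finset (ℕ × Site d) := (Finset.range (m + 1)).biUnion fun j => (Λ j).image (Prod.mk j) with hB
  have hmemB : ∀ p : ℕ × Site d, p ∈ B ↔ p.1 ∈ Finset.range (m + 1) ∧ p.2 ∈ Λ p.1 := by
    intro p
    simp only [hB, Finset.mem_biUnion, Finset.mem_image]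
    constructor
    · rintro ⟨j, hj, y, hy, rfl⟩
      exact ⟨hj, hy⟩
    · rintro ⟨hj, hy⟩
      exact ⟨p.1, hj, p.2, hy, rfl⟩
  let blk : ℕ × Site d → Finset (Site d) := fun p => blockSites (L ^ p.1) p.2
  have hblk : ∀ (p : ℕ × Site d) (x : Site d), x ∈ blk p ↔ blockMapIter L p.1 x = p.2 := fun p x => mem_blockSites_pow_iff p.1 p.2 x
  have hdisj : (↑B : Set (ℕ × Site d)).PairwiseDisjoint blk := by
    intro p hp q hq hne
    rw [Finset.mem_coe, hmemB] at hp hq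
    rw [Function.onFun, Finset.disjoint_left]
    intro x hxp hxq
    rw [hblk] at hxp hxq
    have hne' : (q.1, q.2) ≠ (p.1, p.2) := fun h' => hne (Prod.ext (Prod.ext_iff.1 h').1.symm (Prod.ext_iff.1 h').2.symm)
    exact (hG p.1 hp.1 p.2 hp.2).2 q.1 hq.1 q.2 hq.2 hne' x hxp hxq
  -- `Ω₀` IS the disjoint union of the blocks
  have hcover : s = B.biUnion blk := by
    refine Finset.Subset.antisymm (fun x hx => ?_) (fun x hx => ?_)
    · obtain ⟨j, hj, hy⟩ := hcov x hx
      rw [Finset.mem_biUnion]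
      exact ⟨(j, blockMapIter L j x), (hmemB _).2 ⟨hj, hy⟩, (hblk _ x).2 rfl⟩
    · rw [Finset.mem_biUnion] at hx
      obtain ⟨p, hp, hxp⟩ := hx
      rw [hmemB] at hp
      exact (hG p.1 hp.1 p.2 hp.2).1 x ((hblk p x).1 hxp)
  -- the level sums over `𝔅`
  have hdisjB : (↑(Finset.range (m + 1)) : Set ℕ).PairwiseDisjoint (fun j => (Λ j).image (Prod.mk j)) := by
    intro j₁ _ j₂ _ hne
    rw [Function.onFun, Finset.disjoint_left]
    intro p hp₁ hp₂
    rw [Finset.mem_image] at hp₁ hp₂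
    obtain ⟨y₁, _, rfl⟩ := hp₁
    obtain ⟨y₂, _, h2⟩ := hp₂
    exact hne (Prod.ext_iff.1 h2).1.symm
  have hlevel : ∀ G : ℕ × Site d → ℝ, ∑ j ∈ Finset.range (m + 1), ∑ y ∈ Λ j, G (j, y) = ∑ p ∈ B, G p := by
    intro G
    rw [hB, Finset.sum_biUnion hdisjB]
    refine Finset.sum_congr rfl fun j _ => ?_
    rw [Finset.sum_image fun y _ y' _ h' => (Prod.ext_iff.1 h').2]
  -- (i) the left side, block by block
  have hL : a₀ * formE τ s f f = ∑ p ∈ B, a₀ * ∑ x ∈ blk p, fnorm τ (F x) ^ 2 := by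
    rw [formE_self_eq_sum_sq hτp f, Finset.sum_congr hcover (fun _ _ => rfl), Finset.sum_biUnion hdisj, Finset.mul_sum]
  -- (ii) the per-block inequality (§4)
  have hblock : ∀ p ∈ B, a₀ * ∑ x ∈ blk p, fnorm τ (F x) ^ 2 ≤
      (η ^ 2)⁻¹ * ∑ μ : Fin d, ∑ x ∈ (blk p).filter (fun x => x + e μ ∈ blk p), fnorm τ (F x - F (x + e μ)) ^ 2
        + a p.1 * fnorm τ (QprimeIter (zdBlocking d L) (bgT L (1 : Site d → Fin d → 𝔸ˣ)) p.1 F p.2) ^ 2 := by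
    intro p hp
    rw [hmemB] at hp
    exact block_coercive_one τ hτp hτs hη (hηL p.1 hp.1) (ha p.1) ha₀8 (ha₀ p.1 hp.1) p.2 f
  -- (iii) the right side: gradient energy + penalty
  have hone : ∀ (x : Site d) (κ : Fin d), (1 : Site d → Fin d → 𝔸ˣ) x κ ∈ unitaryUnits 𝔸 := fun _ _ => (unitaryUnits 𝔸).one_mem
  have hR : formE τ s f (deltaPrimeADom L (1 : Site d → Fin d → 𝔸ˣ) η τ hτp m a Λ s f) =
      (∑ μ : Fin d, ∑ᶠ x, fnorm τ (covDerivFwd η (1 : Site d → Fin d → 𝔸ˣ) μ F x) ^ 2) +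
        ∑ p ∈ B, a p.1 * fnorm τ (QprimeIter (zdBlocking d L) (bgT L (1 : Site d → Fin d → 𝔸ˣ)) p.1 F p.2) ^ 2 := by
    rw [formE_deltaPrimeADom (L := L) (m := m) (a := a) (Λ := Λ) τ hτp hτt hτs hone f f]
    congr 1
    · refine Finset.sum_congr rfl fun μ _ => finsum_congr fun x => ?_
      exact (fnorm_sq hτp _).symm
    · rw [← hlevel (fun p => a p.1 * fnorm τ (QprimeIter (zdBlocking d L) (bgT L (1 : Site d → Fin d → 𝔸ˣ)) p.1 F p.2) ^ 2)]
      refine Finset.sum_congr rfl fun j _ => ?_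
      rw [Finset.mul_sum]
      exact Finset.sum_congr rfl fun y _ => by rw [(fnorm_sq hτp _).symm]
  -- (iv) the gradient energy dominates the internal-bond sums of all blocks
  have hgrad : ∀ μ : Fin d,
      (η ^ 2)⁻¹ * ∑ p ∈ B, ∑ x ∈ (blk p).filter (fun x => x + e μ ∈ blk p), fnorm τ (F x - F (x + e μ)) ^ 2 ≤
        ∑ᶠ x, fnorm τ (covDerivFwd η (1 : Site d → Fin d → 𝔸ˣ) μ F x) ^ 2 := by
    intro μ
    -- the finsum as a finite sum over `T = s ∪ (s − e_μ)`
    set T : Finset (Site d) := s ∪ s.image (fun z => z - e μ) with hT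
    have hsupp : (Function.support fun x => fnorm τ (covDerivFwd η (1 : Site d → Fin d → 𝔸ˣ) μ F x) ^ 2) ⊆ ↑T := by
      intro x hx
      rw [Function.mem_support] at hx
      by_contra hxT
      rw [hT, Finset.coe_union, Set.mem_union, Finset.mem_coe, Finset.coe_image, Set.mem_image] at hxT
      simp only [not_or, not_exists, not_and] at hxT
      apply hx
      have h1 : F x = 0 := f.2 x hxT.1
      have h2 : F (x + e μ) = 0 := by
        by_contra hne
        have hmem : x + e μ ∈ s := by by_contra hh; exact hne (f.2 _ hh)
        exact hxT.2 (x + e μ) (Finset.mem_coe.2 hmem) (by simp)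
      rw [fnorm_covDerivFwd_one_sq, h1, h2, sub_zero, fnorm_zero]
      ring
    rw [finsum_eq_sum_of_support_subset _ hsupp]
    -- the internal bonds of the blocks form a sub-finset of `T` (disjointly)
    have hdisjμ : (↑B : Set (ℕ × Site d)).PairwiseDisjoint (fun p => (blk p).filter (fun x => x + e μ ∈ blk p)) := by
      intro p hp q hq hne
      exact Finset.disjoint_filter_filter (hdisj hp hq hne)
    rw [← Finset.sum_biUnion hdisjμ]
    have hsub : B.biUnion (fun p => (blk p).filter (fun x => x + e μ ∈ blk p)) ⊆ T := by
      intro x hx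
      rw [Finset.mem_biUnion] at hx
      obtain ⟨p, hp, hxp⟩ := hx
      rw [Finset.mem_filter] at hxp
      have hxs : x ∈ s := by rw [hcover, Finset.mem_biUnion]; exact ⟨p, hp, hxp.1⟩
      exact Finset.mem_union_left _ hxs
    rw [Finset.mul_sum]
    calc ∑ x ∈ B.biUnion (fun p => (blk p).filter (fun x => x + e μ ∈ blk p)), (η ^ 2)⁻¹ * fnorm τ (F x - F (x + e μ)) ^ 2
        = ∑ x ∈ B.biUnion (fun p => (blk p).filter (fun x => x + e μ ∈ blk p)), fnorm τ (covDerivFwd η (1 : Site d → Fin d → 𝔸ˣ) μ F x) ^ 2 :=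
          Finset.sum_congr rfl fun x _ => (fnorm_covDerivFwd_one_sq τ η μ F x).symm
      _ ≤ ∑ x ∈ T, fnorm τ (covDerivFwd η (1 : Site d → Fin d → 𝔸ˣ) μ F x) ^ 2 :=
          Finset.sum_le_sum_of_subset_of_nonneg hsub fun _ _ _ => sq_nonneg _
  -- (v) assemble
  rw [hL, hR]
  calc ∑ p ∈ B, a₀ * ∑ x ∈ blk p, fnorm τ (F x) ^ 2
      ≤ ∑ p ∈ B, ((η ^ 2)⁻¹ * ∑ μ : Fin d, ∑ x ∈ (blk p).filter (fun x => x + e μ ∈ blk p), fnorm τ (F x - F (x + e μ)) ^ 2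
          + a p.1 * fnorm τ (QprimeIter (zdBlocking d L) (bgT L (1 : Site d → Fin d → 𝔸ˣ)) p.1 F p.2) ^ 2) := Finset.sum_le_sum hblock
    _ = (∑ μ : Fin d, (η ^ 2)⁻¹ * ∑ p ∈ B, ∑ x ∈ (blk p).filter (fun x => x + e μ ∈ blk p), fnorm τ (F x - F (x + e μ)) ^ 2) +
          ∑ p ∈ B, a p.1 * fnorm τ (QprimeIter (zdBlocking d L) (bgT L (1 : Site d → Fin d → 𝔸ˣ)) p.1 F p.2) ^ 2 := by
        rw [Finset.sum_add_distrib]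
        congr 1
        rw [← Finset.mul_sum, ← Finset.mul_sum, Finset.sum_comm]
    _ ≤ _ := by
        gcongr with μ _
        exact hgrad μ

end Assembly

/-! ## §6  The cube members of [Balaban1985RegularSpaces] (1.131): the blocks cover `□₀`, and the flat uniform coercivity there -/

section Cube

variable {L : ℕ}

/-- `Under` composes across one level: `y` in the unit block of `z′` and `x` in the `j`-block of `y` put `x` in the `(j+1)`-block of `z′`.
[cite: Balaban1985RegularSpaces, (1.6) p.77 (bookkeeping)] -/
theorem under_succ_of_under_one_under (hL : 1 ≤ L) {j : ℕ} {z' y x : Site d} (h1 : Under L 1 z' y) (hj : Under L j y x) :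
    Under L (j + 1) z' x := by
  intro i
  obtain ⟨a1, a2⟩ := h1 i
  obtain ⟨b1, b2⟩ := hj i
  have hLj : (0 : ℤ) ≤ (L : ℤ) ^ j := by positivity
  rw [pow_one] at a1 a2
  constructor
  · calc (L : ℤ) ^ (j + 1) * z' i = (L : ℤ) ^ j * ((L : ℤ) * z' i) := by ring
      _ ≤ (L : ℤ) ^ j * y i := mul_le_mul_of_nonneg_left a1 hLj
      _ ≤ x i := b1
  · calc x i + 1 ≤ (L : ℤ) ^ j * (y i + 1) := b2
      _ ≤ (L : ℤ) ^ j * ((L : ℤ) * (z' i + 1)) := mul_le_mul_of_nonneg_left a2 hLj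
      _ = (L : ℤ) ^ (j + 1) * (z' i + 1) := by ring

/-- at the cube tower, `InBox (inLo j) (inHi j) (blockMap (Lʲ) x)` puts `x` in `□_{j+1}` («□_{j+1} is a sum of the big blocks»): the corner `Lʲ•y` of the block lies in `□_{j+1}`
(`smul_mem_cube_succ_iff`), hence the whole `j`-block does. [cite: Balaban1985RegularSpaces, p.98 («□_j is a sum of the big blocks»), (1.131) p.99] -/
theorem mem_cube_succ_of_inBox_in (hL : 1 ≤ L) (a : Site d) (M ρ : ℕ) {k j : ℕ} (hj : j < k) {x : Site d}
    (hin : InBox (inLo L a ρ k j) (inHi L a M ρ k j) (blockMap (L ^ j) x)) : x ∈ cube L a M ρ k (j + 1) := by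
  set y := blockMap (L ^ j) x with hy
  have hcorner : ((L : ℤ) ^ j) • y ∈ cube L a M ρ k (j + 1) := (smul_mem_cube_succ_iff hL a M ρ hj y).2 hin
  obtain ⟨z', hz', hunder⟩ := (mem_cube_iff hL).1 hcorner
  have h1 : Under L 1 z' y := by
    have h := (under_smul_iff hL 1 j z' y)
    rw [Nat.add_comm] at h
    exact h.1 hunder
  have hx : Under L j y x := (under_iff_blockMap_eq hL j y x).2 hy.symm
  exact (mem_cube_iff hL).2 ⟨z', hz', under_succ_of_under_one_under hL h1 hx⟩

/-- `x ∈ □_j ⟹ blockMap (Lʲ) x ∈ □_j^{(j)}`. [cite: Balaban1985RegularSpaces, p.98, (1.131) p.99 (bookkeeping)] -/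
theorem inBox_sq_blockMap_of_mem_cube (hL : 1 ≤ L) {a : Site d} {M ρ k j : ℕ} {x : Site d} (hx : x ∈ cube L a M ρ k j) :
    InBox (sqLo L a ρ k j) (sqHi L a M ρ k j) (blockMap (L ^ j) x) := by
  obtain ⟨z, hz, hunder⟩ := (mem_cube_iff hL).1 hx
  rw [(under_iff_blockMap_eq hL j z x).1 hunder]
  exact hz

/-- ★★ **THE COVER AT A CUBE MEMBER**: every site of `□₀` lies under a constraint point of the truncated family — `∀ x ∈ □₀, ∃ j ≤ m, blockMap^[j] x ∈ cubeLamS … m j`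
(print's «Ω₀ = ⋃_j Bʲ(Λ_j)», `Ω_{k+1} = ∅`, read at the truncation `m ≤ k`: take the deepest `j ≤ m` with `x ∈ □_j`).
[cite: Balaban1985RegularSpaces, (1.5)–(1.6) p.77, (1.68) p.88, (1.131) p.99; Balaban1985BackgroundPropagators, (3.18) p.393] -/
theorem cover_cubeLamS (hL : 1 ≤ L) (a : Site d) (M : ℕ) (ρ : ℕ) {k m : ℕ} {x : Site d}
    (hx : x ∈ cubeFam false L a M ρ k 0) : ∃ j ∈ Finset.range (m + 1), blockMapIter L j x ∈ cubeLamS L a M ρ k m j := by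
  classical
  -- the deepest level `j ≤ m` with `x ∈ □_j`
  let J : Finset ℕ := (Finset.range (m + 1)).filter (fun j => x ∈ cube L a M ρ k j)
  have h0 : 0 ∈ J := by
    rw [Finset.mem_filter]
    refine ⟨Finset.mem_range.2 (Nat.succ_pos m), ?_⟩
    rwa [cubeFam_false_of_le L a M ρ (Nat.zero_le k)] at hx
  have hJ : J.Nonempty := ⟨0, h0⟩
  set j := J.max' hJ with hjdef
  have hjJ : j ∈ J := Finset.max'_mem J hJ
  rw [Finset.mem_filter] at hjJ
  obtain ⟨hjr, hxj⟩ := hjJ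
  have hjm : j ≤ m := Nat.lt_succ_iff.1 (Finset.mem_range.1 hjr)
  refine ⟨j, hjr, ?_⟩
  rw [blockMapIter_eq_blockMap_pow]
  rcases Nat.lt_or_ge j m with hlt | hge
  · -- `j < m`: maximality says `x ∉ □_{j+1}`, so the label avoids `□_{j+1}^{(j)}`
    rw [cubeLamS_of_lt L a M ρ k hlt]
    refine ⟨inBox_sq_blockMap_of_mem_cube hL hxj, fun hjk hin => ?_⟩
    have hx1 : x ∈ cube L a M ρ k (j + 1) := mem_cube_succ_of_inBox_in hL a M ρ hjk hin
    have hmem : j + 1 ∈ J := Finset.mem_filter.2 ⟨Finset.mem_range.2 (by omega), hx1⟩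
    have := Finset.le_max' J (j + 1) hmem
    rw [← hjdef] at this
    omega
  · -- `j = m`: the top truncated class is all of `□_m^{(m)}`
    have hjm' : j = m := le_antisymm hjm hge
    rw [hjm', cubeLamS_self]
    rw [hjm'] at hxj
    exact inBox_sq_blockMap_of_mem_cube hL hxj

end Cube

section CubeMember

variable [FiniteDimensional ℝ 𝔸] {L : ℕ} [NeZero L] {η : ℝ}

include hτt hτs in
/-- ★★★ **THE FLAT UNIFORM COERCIVITY AT EVERY CUBE MEMBER OF (1.131)** (`Λ_j = cubeLamS … m j`, `s = □₀ = i.Ω 0`, `L ≤ ρ`, `m ≤ i.k`): with `i.η·Lʲ ≤ 1` for `j ≤ m`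
(print: `η = L^{−k}`) and weights `a_j` with `a₀·(Lʲ)^d ≤ a_j·η²·(Lʲ)²` (`a₀ ≤ 8`), `a₀·⟨f, f⟩_τ ≤ ⟨f, □₀Δ′_a(1)□₀ f⟩_τ` for every `f ∈ L²(□₀, ·)` — NO geometric
hypothesis left (the blocks lie in `□₀` and are disjoint: dag-n05-c∕-e's `towers_disjoint_cube` ∕ `towerBlock_subset_cube` road, here `§2` of `B9Eq319QQStarDiagonalZd`'s
argument inlined; they cover `□₀`: `cover_cubeLamS`), ONE constant for the whole cube family.
[cite: Balaban1984PropagatorsII, (2.22) p.226, (2.26)–(2.27) p.235; Balaban1985BackgroundPropagators, Thm 3.1 p.397, Thm 3.11 p.416; Balaban1985RegularSpaces, (1.131) p.99] -/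
theorem formE_deltaPrimeADom_one_coercive_cubeMember (hη : 0 < η) {a₁ : ℕ → ℝ} (ha : ∀ j, 0 ≤ a₁ j)
    (i : ZdIdx d L) {a : Site d} {Mc ρ : ℕ} (hΩ : i.Ω = cubeFam false L a Mc ρ i.k) (hρ : L ≤ ρ) {m : ℕ} (hm : m ≤ i.k)
    (hηL : ∀ j ∈ Finset.range (m + 1), η * (L : ℝ) ^ j ≤ 1)
    {a₀ : ℝ} (ha₀8 : a₀ ≤ 8) (ha₀ : ∀ j ∈ Finset.range (m + 1), a₀ * ((L : ℝ) ^ j) ^ d ≤ a₁ j * η ^ 2 * ((L : ℝ) ^ j) ^ 2)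
    (f : suppSub (𝔸 := 𝔸) (cubeMember_Ω0_finite i hΩ).toFinset) :
    a₀ * formE τ (cubeMember_Ω0_finite i hΩ).toFinset f f ≤
      formE τ (cubeMember_Ω0_finite i hΩ).toFinset f
        (deltaPrimeADom L (1 : Site d → Fin d → 𝔸ˣ) η τ hτp m a₁ (fun j => (cubeLamS_finite L a Mc ρ i.k m j).toFinset)
          (cubeMember_Ω0_finite i hΩ).toFinset f) := by
  have hL1 : 1 ≤ L := Nat.one_le_iff_ne_zero.2 (NeZero.ne L)
  have hs : ∀ x, x ∈ (cubeMember_Ω0_finite i hΩ).toFinset ↔ x ∈ cubeFam false L a Mc ρ i.k 0 := by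
    intro x
    rw [Set.Finite.mem_toFinset, hΩ]
  have hΛ : ∀ j y, y ∈ (cubeLamS_finite L a Mc ρ i.k m j).toFinset ↔ y ∈ cubeLamS L a Mc ρ i.k m j :=
    fun j y => Set.Finite.mem_toFinset _
  refine formE_deltaPrimeADom_one_coercive_uniform τ hτp hτt hτs hη m ha _ (fullBlockGeometry_cubeMember i hΩ hρ hm)
    (fun x hx => ?_) hηL ha₀8 ha₀ f
  -- the cover
  obtain ⟨j, hj, hmem⟩ := cover_cubeLamS hL1 a Mc ρ ((hs x).1 hx)
  exact ⟨j, hj, (hΛ j _).2 hmem⟩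

end CubeMember

end Literature.MathematicalPhysics.QuantumFieldTheory.Balaban1983to89.B9Thm31FlatPoincareCoerciveZd

end
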